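import Summits.Ventures.PercRepro.OrbitK

/-!
# PercRepro — S2: THE EXACT CONSTANT `Φ(16, 5)` (p7, gen 9)

`Φ(16, 5) = Σ_{5<u<16} C(21, u) / C(21, 16) = (2^21 − 2·27896)/20349 = 2041360/20349 = 100.3175…`, against the
kit's `2^21/C(21, 5) = 103.06…` (`phiK_le_two_pow_div`): the cell arithmetic of the `p = 16` row of the `q = 5` window
may use the exact value (`−2.7 %` on the `U`-term; the need at `(16, 7)` becomes `U ≤ 78,266`). Axioms: standard.
-/

namespace PercRepro

namespace S2

/-- `Φ(16, 5) = 2041360 / 20349` exactly. -/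
theorem phiK_sixteen_five : phiK 16 5 = 2041360 / 20349 := by
  unfold phiK
  rw [show Finset.Ioo 5 16 = Finset.Icc 6 15 from rfl]
  simp only [Finset.sum_Icc_succ_top (show 6 ≤ 15 by norm_num), Finset.sum_Icc_succ_top (show 6 ≤ 14 by norm_num),
    Finset.sum_Icc_succ_top (show 6 ≤ 13 by norm_num), Finset.sum_Icc_succ_top (show 6 ≤ 12 by norm_num),
    Finset.sum_Icc_succ_top (show 6 ≤ 11 by norm_num), Finset.sum_Icc_succ_top (show 6 ≤ 10 by norm_num),
    Finset.sum_Icc_succ_top (show 6 ≤ 9 by norm_num), Finset.sum_Icc_succ_top (show 6 ≤ 8 by norm_num),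
    Finset.sum_Icc_succ_top (show 6 ≤ 7 by norm_num), Finset.Icc_self, Finset.sum_singleton]
  norm_num [Nat.choose]

/-- The exact constant is smaller than the kit's `2^{p+5}/C(p+5, 5)` bound at `p = 16`: `Φ(16, 5) ≤ 2^21 / 20349`. -/
theorem phiK_sixteen_five_le : phiK 16 5 ≤ 2 ^ 21 / 20349 := by
  rw [phiK_sixteen_five]; norm_num

end S2

end PercRepro
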